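import Literature.NumberTheory.Transcendental.OnePeriodsClosedPathsProofs
import Mathlib.Analysis.SpecialFunctions.Sqrt
import Mathlib.Analysis.SpecialFunctions.Trigonometric.Deriv
import Mathlib.RingTheory.Algebraic.Integral
import HarnessLib

/-!
# Complete periods of plane curves: the genus-one calibration (an elliptic period)

Companion of `Literature/NumberTheory/Transcendental/OnePeriodsClosedPaths.lean` (the named fact
`Literature.NumberTheory.Transcendental.completePlaneCurvePeriods_zero_or_transcendental`;
Huber–Wüstholz, *Transcendence and Linear Relations of 1-Periods*, Cambridge Tracts 227 (2022),
Cor. 13.13, p. 126 of the held text) and of `OnePeriodsClosedPathsProofs.lean` (the genus-`0`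
calibration: the fact contains the transcendence of `2πi`).

The genus-`0` slices of the fact are theorems (`OnePeriodsClosedPathsGenusZero/Conics/Rational/
DegOne.lean`, all reducing to Lindemann).  This file shows that the fact has genuine GENUS-ONE
content, by exhibiting an explicit datum of positive genus satisfying all its hypotheses with a
non-zero complete period: on the elliptic curve `y² = 4x³ − 4x` (smooth, `g₂ = 4`, `g₃ = 0`) the
real oval over `−1 ≤ x ≤ 0` is the smooth closed loop
`γ(t) = ((cos 2πt − 1)/2, sin 2πt · √((3 − cos 2πt)/2))`, and the polynomial form
`ω = −(9/8) x y dx + ((3/4) x² − 1/2) dy` restricts on the curve to the invariant differential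
`dx/y` (Bezout: `u f + v f′ = 1` with `f = 4x³ − 4x`, `u = −(9/8)x`, `v = (3/8)x² − 1/4`,
`ω = u y dx + 2 v dy`).  Along `γ` the integrand is identically `−π/√((3 − cos 2πt)/2) < 0`, so

  `∮_γ ω = −∫₀¹ π dt / √((3 − cos 2πt)/2) ≠ 0`

(a complete elliptic integral of the first kind; by the substitution `x = (cos 2πt − 1)/2` it is
`−2∫_{−1}^{0} dx/√(4x³ − 4x)`, a real period of the curve — Lawden, *Elliptic Functions and
Applications*, (6.12.18); this identification is not needed here).  Hence the named fact implies
the transcendence of this elliptic integral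
(`completePlaneCurvePeriods_zero_or_transcendental.transcendental_ellipticIntegral`) — the
instance "periods of elliptic curves" of Huber–Wüstholz, Remark 13.10, i.e. Schneider's theorem
(1937), which no genus-`0` argument reaches.

## References

* A. Huber, G. Wüstholz, *Transcendence and Linear Relations of 1-Periods*, Cambridge Tracts in
  Mathematics 227, CUP 2022 [HuberWustholz2022]: Remark 13.10 (p. 125), Cor. 13.13 (p. 126).
* Th. Schneider, *Arithmetische Untersuchungen elliptischer Integrale*, Math. Ann. 113 (1937).
* D. F. Lawden, *Elliptic Functions and Applications*, Springer 1989, §6.12.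
-/

noncomputable section

open MvPolynomial Complex
open scoped Real

namespace Literature.NumberTheory.Transcendental

namespace ClosedPathPeriods

namespace EllipticCalibration

/-! ### The real loop `γ(t) = ((cos 2πt − 1)/2, sin 2πt · √((3 − cos 2πt)/2))` -/

/-- `ρ(t) = √((3 − cos 2πt)/2)` (`= √(1 − x(t))`). [folklore] -/
def rho (t : ℝ) : ℝ := Real.sqrt ((3 - Real.cos (2 * π * t)) / 2)

/-- `x(t) = (cos 2πt − 1)/2 ∈ [−1, 0]`. [folklore] -/
def xr (t : ℝ) : ℝ := (Real.cos (2 * π * t) - 1) / 2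

/-- `y(t) = sin 2πt · ρ(t)`. [folklore] -/
def yr (t : ℝ) : ℝ := Real.sin (2 * π * t) * rho t

/-- `(3 − cos 2πt)/2 > 0`. [folklore] -/
theorem rho_arg_pos (t : ℝ) : 0 < (3 - Real.cos (2 * π * t)) / 2 := by
  have h := Real.cos_le_one (2 * π * t)
  linarith

/-- `ρ(t) > 0`. [folklore] -/
theorem rho_pos (t : ℝ) : 0 < rho t := Real.sqrt_pos.2 (rho_arg_pos t)

/-- `ρ(t)² = (3 − cos 2πt)/2`. [folklore] -/
theorem rho_sq (t : ℝ) : rho t ^ 2 = (3 - Real.cos (2 * π * t)) / 2 :=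
  Real.sq_sqrt (rho_arg_pos t).le

/-- `(cos 2πt)′ = −2π sin 2πt`. [folklore] -/
theorem hasDerivAt_cos_two_pi_mul (t : ℝ) :
    HasDerivAt (fun s => Real.cos (2 * π * s)) (-(2 * π) * Real.sin (2 * π * t)) t := by
  have h := (Real.hasDerivAt_cos (2 * π * t)).comp t ((hasDerivAt_id t).const_mul (2 * π))
  simp only [mul_one, Function.comp_def] at h
  exact h.congr_deriv (by ring)

/-- `(sin 2πt)′ = 2π cos 2πt`. [folklore] -/
theorem hasDerivAt_sin_two_pi_mul (t : ℝ) :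
    HasDerivAt (fun s => Real.sin (2 * π * s)) (2 * π * Real.cos (2 * π * t)) t := by
  have h := (Real.hasDerivAt_sin (2 * π * t)).comp t ((hasDerivAt_id t).const_mul (2 * π))
  simp only [mul_one, Function.comp_def] at h
  exact h.congr_deriv (by ring)

/-- `x′(t) = −π sin 2πt`. [folklore] -/
theorem hasDerivAt_xr (t : ℝ) : HasDerivAt xr (-π * Real.sin (2 * π * t)) t := by
  have h := ((hasDerivAt_cos_two_pi_mul t).sub_const 1).div_const 2
  unfold xr
  exact h.congr_deriv (by ring)

/-- `ρ′(t) = π sin 2πt / (2ρ(t))`. [folklore] -/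
theorem hasDerivAt_rho (t : ℝ) :
    HasDerivAt rho (π * Real.sin (2 * π * t) / (2 * rho t)) t := by
  have hu : HasDerivAt (fun s => (3 - Real.cos (2 * π * s)) / 2) (π * Real.sin (2 * π * t)) t := by
    have h := ((hasDerivAt_cos_two_pi_mul t).const_sub 3).div_const 2
    exact h.congr_deriv (by ring)
  have h := (Real.hasDerivAt_sqrt (rho_arg_pos t).ne').comp t hu
  unfold rho
  exact h.congr_deriv (by ring)

/-- `y′(t) = 2π cos 2πt · ρ + sin 2πt · ρ′`. [folklore] -/
theorem hasDerivAt_yr (t : ℝ) :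
    HasDerivAt yr (2 * π * Real.cos (2 * π * t) * rho t +
      Real.sin (2 * π * t) * (π * Real.sin (2 * π * t) / (2 * rho t))) t := by
  unfold yr
  exact (hasDerivAt_sin_two_pi_mul t).mul (hasDerivAt_rho t)

/-- `x` is `C¹`. [folklore] -/
theorem contDiff_xr : ContDiff ℝ 1 xr := by
  unfold xr
  exact ((Real.contDiff_cos.comp (contDiff_const.mul contDiff_id)).sub contDiff_const).div_const 2

/-- `ρ` is `C¹` (the radicand stays `≥ 1`). [folklore] -/
theorem contDiff_rho : ContDiff ℝ 1 rho := by
  unfold rho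
  exact ((contDiff_const.sub (Real.contDiff_cos.comp (contDiff_const.mul contDiff_id))).div_const
    2).sqrt fun t => (rho_arg_pos t).ne'

/-- `y` is `C¹`. [folklore] -/
theorem contDiff_yr : ContDiff ℝ 1 yr := by
  unfold yr
  exact (Real.contDiff_sin.comp (contDiff_const.mul contDiff_id)).mul contDiff_rho

/-- The loop `γ(t) = (x(t), y(t))` in `ℂ²`. [folklore] -/
def loop (t : ℝ) : Fin 2 → ℂ := ![(xr t : ℂ), (yr t : ℂ)]

/-- First coordinate of the loop. [folklore] -/
theorem loop_zero (t : ℝ) : loop t 0 = (xr t : ℂ) := rfl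

/-- Second coordinate of the loop. [folklore] -/
theorem loop_one (t : ℝ) : loop t 1 = (yr t : ℂ) := rfl

/-- The loop is `C¹`. [folklore] -/
theorem contDiff_loop : ContDiff ℝ 1 loop := by
  refine contDiff_pi.2 fun i => ?_
  fin_cases i
  · exact Complex.ofRealCLM.contDiff.comp contDiff_xr
  · exact Complex.ofRealCLM.contDiff.comp contDiff_yr

/-- The loop has period `1`. [folklore] -/
theorem periodic_loop : Function.Periodic loop 1 := by
  intro t
  have hc : Real.cos (2 * π * (t + 1)) = Real.cos (2 * π * t) := by
    rw [mul_add, mul_one, Real.cos_add_two_pi]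
  have hs : Real.sin (2 * π * (t + 1)) = Real.sin (2 * π * t) := by
    rw [mul_add, mul_one, Real.sin_add_two_pi]
  funext i
  fin_cases i
  · simp [loop, xr, hc]
  · simp [loop, yr, rho, hc, hs]

/-- Derivative of the first coordinate of the loop. [folklore] -/
theorem deriv_loop_zero (t : ℝ) :
    deriv (fun s => loop s 0) t = ((-π * Real.sin (2 * π * t) : ℝ) : ℂ) :=
  ((hasDerivAt_xr t).ofReal_comp).deriv

/-- Derivative of the second coordinate of the loop. [folklore] -/
theorem deriv_loop_one (t : ℝ) : deriv (fun s => loop s 1) t =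
    ((2 * π * Real.cos (2 * π * t) * rho t +
      Real.sin (2 * π * t) * (π * Real.sin (2 * π * t) / (2 * rho t)) : ℝ) : ℂ) :=
  ((hasDerivAt_yr t).ofReal_comp).deriv

/-! ### The curve `y² = 4x³ − 4x` and the form `−(9/8) x y dx + ((3/4) x² − 1/2) dy` -/

/-- `p = y² − 4x³ + 4x`. [folklore] -/
def curve : MvPolynomial (Fin 2) ℚ := X 1 ^ 2 - C 4 * X 0 ^ 3 + C 4 * X 0

/-- `A = −(9/8) x y` (`= u y`, `u = −(9/8) x`). [folklore] -/
def formA : MvPolynomial (Fin 2) ℚ := C (-9 / 8) * X 0 * X 1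

/-- `B = (3/4) x² − 1/2` (`= 2v`, `v = (3/8) x² − 1/4`; `u f + v f′ = 1`). [folklore] -/
def formB : MvPolynomial (Fin 2) ℚ := C (3 / 4) * X 0 ^ 2 - C (1 / 2)

/-- Evaluating `p = y² − 4x³ + 4x`. [folklore] -/
theorem aeval_curve (z : Fin 2 → ℂ) : aeval z curve = z 1 ^ 2 - 4 * z 0 ^ 3 + 4 * z 0 := by
  simp only [curve, map_add, map_sub, map_mul, map_pow, aeval_X, map_ofNat]

/-- `∂ₓp = −12x² + 4` at a point. [folklore] -/
theorem aeval_pderiv_zero_curve (z : Fin 2 → ℂ) :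
    aeval z (pderiv 0 curve) = -(12 * z 0 ^ 2) + 4 := by
  have hpd : pderiv 0 curve = -(C 4 * (3 * X 0 ^ 2)) + C 4 := by
    simp only [curve, map_add, map_sub, Derivation.leibniz, Derivation.leibniz_pow, pderiv_C,
      pderiv_X_self, pderiv_X_of_ne (R := ℚ) (i := (0 : Fin 2)) (j := (1 : Fin 2)) (by decide),
      smul_zero, smul_eq_mul, mul_one, mul_zero, add_zero, zero_sub, nsmul_eq_mul]
    ring
  rw [hpd]
  simp only [map_add, map_neg, map_mul, map_pow, aeval_X, map_ofNat]
  ring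

/-- `∂_yp = 2y` at a point. [folklore] -/
theorem aeval_pderiv_one_curve (z : Fin 2 → ℂ) : aeval z (pderiv 1 curve) = 2 * z 1 := by
  have hpd : pderiv 1 curve = 2 * X 1 := by
    simp only [curve, map_add, map_sub, Derivation.leibniz, Derivation.leibniz_pow, pderiv_C,
      pderiv_X_self, pderiv_X_of_ne (R := ℚ) (i := (1 : Fin 2)) (j := (0 : Fin 2)) (by decide),
      smul_zero, smul_eq_mul, mul_one, mul_zero, add_zero, sub_zero, nsmul_eq_mul]
    ring
  rw [hpd]
  simp only [map_mul, map_ofNat, aeval_X]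

/-- Evaluating `A = −(9/8) x y`. [folklore] -/
theorem aeval_formA (z : Fin 2 → ℂ) : aeval z formA = -9 / 8 * z 0 * z 1 := by
  simp only [formA, map_mul, aeval_C, aeval_X, map_div₀, map_neg, map_ofNat]

/-- Evaluating `B = (3/4) x² − 1/2`. [folklore] -/
theorem aeval_formB (z : Fin 2 → ℂ) : aeval z formB = 3 / 4 * z 0 ^ 2 - 1 / 2 := by
  simp only [formB, map_sub, map_mul, map_pow, aeval_C, aeval_X, map_div₀, map_ofNat, map_one]

/-- The real loop lies on `y² = 4x³ − 4x`. [folklore] -/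
theorem on_curve_real (t : ℝ) : yr t ^ 2 - 4 * xr t ^ 3 + 4 * xr t = 0 := by
  have hρ := rho_sq t
  have hsc := Real.sin_sq_add_cos_sq (2 * π * t)
  unfold yr xr
  linear_combination (Real.sin (2 * π * t) ^ 2) * hρ +
    ((3 - Real.cos (2 * π * t)) / 2) * hsc

/-- The loop lies on the curve `p = 0`. [folklore] -/
theorem loop_on_curve (t : ℝ) : aeval (loop t) curve = 0 := by
  rw [aeval_curve, loop_zero, loop_one]
  exact_mod_cast on_curve_real t

/-- The loop lies in the smooth locus (`∇p ≠ 0` along it: `∂_yp = 2y`, and where `y = 0` one has `x ∈ {0, −1}`, `∂ₓp ∈ {4, −8}`). [folklore] -/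
theorem loop_smooth_point (t : ℝ) : ∃ j, aeval (loop t) (pderiv j curve) ≠ 0 := by
  by_cases hy : yr t = 0
  · -- then `sin 2πt = 0`, `cos² 2πt = 1`, and `∂ₓp = −12x² + 4 = 1 − 3cos² − ... ≠ 0`
    refine ⟨0, ?_⟩
    have hs : Real.sin (2 * π * t) = 0 := by
      rcases mul_eq_zero.1 hy with h | h
      · exact h
      · exact absurd h (rho_pos t).ne'
    have hc2 : Real.cos (2 * π * t) ^ 2 = 1 := by
      have h := Real.sin_sq_add_cos_sq (2 * π * t)
      rw [hs] at h
      linarith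
    rw [aeval_pderiv_zero_curve, loop_zero]
    have hreal : -(12 * xr t ^ 2) + 4 ≠ 0 := by
      have hc : Real.cos (2 * π * t) = 1 ∨ Real.cos (2 * π * t) = -1 :=
        mul_self_eq_one_iff.1 (by rw [← sq]; exact hc2)
      unfold xr
      rcases hc with hc | hc <;> rw [hc] <;> norm_num
    exact_mod_cast hreal
  · refine ⟨1, ?_⟩
    rw [aeval_pderiv_one_curve, loop_one]
    exact_mod_cast mul_ne_zero two_ne_zero hy


/-! ### Along the loop the form is `dx/y = −π dt/ρ(t)` -/

/-- The real identity behind `ω = dx/y` along `γ`: `u y x′ + 2v y′ = −π/ρ`. [folklore] -/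
theorem integrand_real (t : ℝ) :
    -9 / 8 * xr t * yr t * (-π * Real.sin (2 * π * t)) +
      (3 / 4 * xr t ^ 2 - 1 / 2) * (2 * π * Real.cos (2 * π * t) * rho t +
        Real.sin (2 * π * t) * (π * Real.sin (2 * π * t) / (2 * rho t))) = -π / rho t := by
  have hρ := rho_sq t
  have hρ0 := (rho_pos t).ne'
  have hsc := Real.sin_sq_add_cos_sq (2 * π * t)
  have hinv : (rho t)⁻¹ * rho t = 1 := inv_mul_cancel₀ hρ0
  -- the polynomial identity after multiplying by `ρ` and substituting `ρ² = (3 − cos)/2`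
  have key : 9 / 8 * π * xr t * Real.sin (2 * π * t) ^ 2 * rho t ^ 2 +
      (3 / 4 * xr t ^ 2 - 1 / 2) * (2 * π * Real.cos (2 * π * t)) * rho t ^ 2 +
      (3 / 4 * xr t ^ 2 - 1 / 2) * π * Real.sin (2 * π * t) ^ 2 / 2 = -π := by
    rw [hρ]
    unfold xr
    linear_combination (9 / 8 * π * ((Real.cos (2 * π * t) - 1) / 2) *
      ((3 - Real.cos (2 * π * t)) / 2) +
      (3 / 4 * ((Real.cos (2 * π * t) - 1) / 2) ^ 2 - 1 / 2) * π / 2) * hsc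
  rw [eq_div_iff hρ0]
  unfold yr
  linear_combination key +
    ((3 / 4 * xr t ^ 2 - 1 / 2) * π * Real.sin (2 * π * t) ^ 2 / 2) * hinv

/-- **The integrand of `∮_γ ω` is `−π/ρ(t)`** (real, negative). [folklore] -/
theorem integrand_eq (t : ℝ) :
    aeval (loop t) formA * deriv (fun s => loop s 0) t +
      aeval (loop t) formB * deriv (fun s => loop s 1) t = ((-π / rho t : ℝ) : ℂ) := by
  rw [aeval_formA, aeval_formB, deriv_loop_zero, deriv_loop_one, loop_zero, loop_one,
    ← integrand_real t]
  push_cast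
  ring

/-- The elliptic integral `I = ∫₀¹ π dt/√((3 − cos 2πt)/2)` is positive. [folklore] -/
theorem ellipticIntegral_pos : 0 < ∫ t in (0:ℝ)..1, π / rho t := by
  refine intervalIntegral.intervalIntegral_pos_of_pos ?_ (fun t => div_pos Real.pi_pos (rho_pos t))
    zero_lt_one
  exact (continuous_const.div contDiff_rho.continuous fun t => (rho_pos t).ne').intervalIntegrable
    0 1

/-- **The complete period `∮_γ ω = −I`**, `I = ∫₀¹ π dt/√((3 − cos 2πt)/2) > 0`. [folklore] -/
theorem completePeriod_eq :
    (∫ t in (0:ℝ)..1, (aeval (loop t) formA * deriv (fun s => loop s 0) t +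
        aeval (loop t) formB * deriv (fun s => loop s 1) t)) =
      -((∫ t in (0:ℝ)..1, π / rho t : ℝ) : ℂ) := by
  simp_rw [integrand_eq]
  rw [intervalIntegral.integral_ofReal, ← Complex.ofReal_neg, ← intervalIntegral.integral_neg]
  congr 1
  refine intervalIntegral.integral_congr fun t _ => ?_
  simp only [neg_div]

end EllipticCalibration

open EllipticCalibration in
/-- **Non-vacuity of the named fact in genus one.** The elliptic curve `y² = 4x³ − 4x`, the
polynomial form `ω = −(9/8) x y dx + ((3/4) x² − 1/2) dy` (`= dx/y` on the curve) and the smooth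
closed loop `γ(t) = ((cos 2πt − 1)/2, sin 2πt √((3 − cos 2πt)/2))` (the real oval over
`[−1, 0]`, inside the smooth locus) satisfy all hypotheses of
`completePlaneCurvePeriods_zero_or_transcendental`, with complete period
`∮_γ ω = −∫₀¹ π dt/√((3 − cos 2πt)/2) < 0` — an elliptic period (Huber–Wüstholz, Remark 13.10:
"periods … of elliptic curves"). [cite: HuberWustholz2022, Remark 13.10 (p. 125)] -/
theorem exists_completePeriod_elliptic :
    ∃ γ : ℝ → (Fin 2 → ℂ), ContDiff ℝ 1 γ ∧ Function.Periodic γ 1 ∧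
      (∀ t, aeval (γ t) curve = 0 ∧ ∃ j, aeval (γ t) (pderiv j curve) ≠ 0) ∧
      (∫ t in (0:ℝ)..1, (aeval (γ t) formA * deriv (fun s => γ s 0) t +
          aeval (γ t) formB * deriv (fun s => γ s 1) t)) =
        -((∫ t in (0:ℝ)..1, π / Real.sqrt ((3 - Real.cos (2 * π * t)) / 2) : ℝ) : ℂ) ∧
      0 < ∫ t in (0:ℝ)..1, π / Real.sqrt ((3 - Real.cos (2 * π * t)) / 2) :=
  ⟨loop, contDiff_loop, periodic_loop, fun t => ⟨loop_on_curve t, loop_smooth_point t⟩,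
    completePeriod_eq, ellipticIntegral_pos⟩

end ClosedPathPeriods

open ClosedPathPeriods ClosedPathPeriods.EllipticCalibration in
/-- **The named fact contains the transcendence of an elliptic period** (its genus-one
calibration).  Applied to the datum of `ClosedPathPeriods.exists_completePeriod_elliptic` (one
loop, `n₁ = 1`), `completePlaneCurvePeriods_zero_or_transcendental` yields that the complete
elliptic integral of the first kind

  `∫₀¹ π dt / √((3 − cos 2πt)/2)`  (`= 2∫_{−1}^{0} dx/√(4x³ − 4x)`, a real period of `y² = 4x³ − 4x`)

is transcendental — the instance "periods of elliptic curves" of Huber–Wüstholz, Remark 13.10,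
i.e. Schneider's theorem (1937); unlike the genus-`0` calibration (`transcendental_two_pi_I`,
Lindemann) this is not reachable by residues. [cite: HuberWustholz2022, Remark 13.10 (p. 125) and Cor. 13.13 (p. 126)] -/
theorem completePlaneCurvePeriods_zero_or_transcendental.transcendental_ellipticIntegral
    (h : completePlaneCurvePeriods_zero_or_transcendental) :
    Transcendental ℚ (∫ t in (0:ℝ)..1, π / Real.sqrt ((3 - Real.cos (2 * π * t)) / 2)) := by
  obtain ⟨γ, hγ, hper, hon, hS, hpos⟩ := ClosedPathPeriods.exists_completePeriod_elliptic
  intro halg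
  have h1 := h curve formA formB 1 (fun _ => 1) (fun _ => γ) (fun _ => ⟨hγ, hper, hon⟩)
  simp only [Fin.sum_univ_one, Int.cast_one, one_mul] at h1
  rw [hS] at h1
  have halgC : IsAlgebraic ℚ
      (-((∫ t in (0:ℝ)..1, π / Real.sqrt ((3 - Real.cos (2 * π * t)) / 2) : ℝ) : ℂ)) := by
    have h0 : IsAlgebraic ℚ
        ((∫ t in (0:ℝ)..1, π / Real.sqrt ((3 - Real.cos (2 * π * t)) / 2) : ℝ) : ℂ) := by
      rw [← Complex.coe_algebraMap]
      exact (isAlgebraic_algebraMap_iff Complex.ofReal_injective).mpr halg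
    exact h0.neg
  have h2 := h1 halgC
  rw [neg_eq_zero, Complex.ofReal_eq_zero] at h2
  exact hpos.ne' h2

end Literature.NumberTheory.Transcendental

end
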